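/-
[OURS · L1 W4.5(b) · EL♮(3)] SPECIMEN-Q DOWNSTAIRS — part G2 (global two-step regularity).
[claim: Hironaka2017, status: under-review]
-/
import Summits.ResolutionOfSingularities.ResolutionOfSingularities.Theorems.EquisingularLiftEquisingularLiftNatSpecimenQuarticTcDeltaLocalTwoStep
import Summits.ResolutionOfSingularities.ResolutionOfSingularities.Theorems.EquisingularLiftEquisingularLiftNatSpecimenQuarticTcDeltaGammaChart
import Summits.ResolutionOfSingularities.ResolutionOfSingularities.Theorems.EquisingularLiftEquisingularLiftReducedStrictTransformBlowup
import Literature.AlgebraicGeometry.Resolution.BlowupDisjointCentreSplitting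
import Literature.AlgebraicGeometry.Resolution.BlowupsProperProofs

/-!
# [OURS · L1 W4.5(b) · EL♮(3)] SPECIMEN-Q DOWNSTAIRS, part G — GLOBAL TWO-STEP REGULARITY
# (crux `EquisingularLiftNatThree` = stmt-ResolutionOfSingularities-20148, line `sections3`; res-L1-w45b-lead-2 CUT 2026-08-27T08:41:07Z
# «SPECIMEN-Q DOWNSTAIRS» to res-D-pv-034 AS res-L1-s36-pv-3; helper, closes nothing)

HONEST FRAMING. OURS (cell `res-hironaka`, chain w45b, slot W4.5(b)); NOT a statement of any manuscript; AI-written, weaker than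
expert review.

Setting of `…TcDeltaChartStep`: a locally Noetherian ambient `Y`, a chart `w : Spec k[X] → Y` (open immersion) with `𝓘_T · 𝒪 =
(z² + x⁴ + y⁴)~` for a closed irreducible `T`, the closed point `y₀ = w(o)`, the blow-up `β : Y′ → Y` at `y₀` and the blow-up
`β′ : Y″ → Y′` at `Z = β⁻¹{y₀} ∩ closure β⁻¹(T ∖ {y₀})`. We prove that the reduced strict transform
`Γ″ = V(closure T″)_red`, `T″ = closure β′⁻¹(closure β⁻¹(T ∖ {y₀}) ∖ Z)`, is REGULAR at every point lying over the chart
(`isRegularLocalRing_twoStep_of_mem_range`), and regular at every point lying over an open `O ∌ y₀` over which `Γ = V(closure T)_red`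
is regular (`isRegularLocalRing_twoStep_of_mem_open`).

Mechanism: the tree's reduced-strict-transform blow-up lemma (`EquisingularLift.exists_isBlowup_reducedStrictTransform`, Stacks 080E)
twice gives `Γ″ → Γ′ → Γ` as blow-ups along the traces of the centres; over the chart, `Γ ⊇ Γι⁻¹(w(Spec k[X])) ≅ Spec k[X]/(f) = Spec D₀`
(`K.subschemeCover`), the traces are `𝔪̄₀~` and `𝓘(ρ⁻¹ pt)`, and `…TcDeltaLocalTwoStep.isRegular_twoStep` applies; off `y₀` both
blow-ups are isomorphisms.

References: Stacks 080E, 0806, 02NS; Hartshorne II 7.13–7.16 (via the cited tree files).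
-/

set_option linter.dupNamespace false -- mandated namespace `Summit.<Summit>.<Problem>` of this single-conjunct summit

noncomputable section

open CategoryTheory CategoryTheory.Limits AlgebraicGeometry TopologicalSpace
open MvPolynomial
open AlgebraicGeometry.Scheme.IdealSheafData
open Literature.AlgebraicGeometry.Resolution
open Summit.ResolutionOfSingularities.ResolutionOfSingularities.Theorems.EquisingularLift

namespace Summit.ResolutionOfSingularities.ResolutionOfSingularities.Cruxes.EquisingularLiftNat.Sections

namespace SpecimenQuarticTcDelta

/-! ## The global two-step regularity -/

section TwoStep

variable {k : Type} [Field k] [IsAlgClosed k]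
variable {Y Y' Y'' : Scheme.{0}} [IsLocallyNoetherian Y]
  (w : Spec (CommRingCat.of (MvPolynomial (Fin 3) k)) ⟶ Y) [IsOpenImmersion w]
  (hc : IsClosed ({w (o k)} : Set Y))
  {T : Set Y} (hTc : IsClosed T) (hTirr : IsIrreducible T)
  (hwT : (vanishingIdeal (⟨T, hTc⟩ : Closeds Y)).comap w =
    ofIdealTop ((Ideal.span {(X 2 ^ 2 + X 0 ^ 4 + X 1 ^ 4 : MvPolynomial (Fin 3) k)}).map
      (Scheme.ΓSpecIso (CommRingCat.of (MvPolynomial (Fin 3) k))).inv.hom))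
  (hwo : w (o k) ∈ T) (h2 : (2 : k) ≠ 0)
  {β : Y' ⟶ Y} (hβ : IsBlowup β (vanishingIdeal (⟨{w (o k)}, hc⟩ : Closeds Y)))
  {β' : Y'' ⟶ Y'}
  (hβ' : IsBlowup β' (vanishingIdeal (⟨β ⁻¹' {w (o k)} ∩ closure (β ⁻¹' (T \ {w (o k)})), isClosed_inter hc β⟩ : Closeds Y')))

include hTirr hwT hwo h2 hβ hβ' in
/-- **GLOBAL TWO-STEP REGULARITY, core (strict transforms in the «support» spelling of the tree's strict-transform lemma).**
(1) `Γ″` is regular at every point over the chart `w(Spec k[X])`; (2) `Γ″` is regular at every point over an open `O ∌ w(o)` over which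
`Γ` is regular. [OURS · L1 W4.5b · SPECIMEN-Q DOWNSTAIRS R1] [cite: StacksProject, Tag 080E] -/
theorem twoStep_core :
    (∀ z : (vanishingIdeal (⟨closure (β' ⁻¹' (closure (β ⁻¹' (closure T \
        ((vanishingIdeal (⟨{w (o k)}, hc⟩ : Closeds Y)).support : Set Y))) \
        ((vanishingIdeal (⟨β ⁻¹' {w (o k)} ∩ closure (β ⁻¹' (T \ {w (o k)})), isClosed_inter hc β⟩ : Closeds Y')).support :
          Set Y'))), isClosed_closure⟩ : Closeds Y'')).subscheme,
      β (β' ((vanishingIdeal (⟨closure (β' ⁻¹' (closure (β ⁻¹' (closure T \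
        ((vanishingIdeal (⟨{w (o k)}, hc⟩ : Closeds Y)).support : Set Y))) \
        ((vanishingIdeal (⟨β ⁻¹' {w (o k)} ∩ closure (β ⁻¹' (T \ {w (o k)})), isClosed_inter hc β⟩ : Closeds Y')).support :
          Set Y'))), isClosed_closure⟩ : Closeds Y'')).subschemeι z)) ∈ Set.range w →
      IsRegularLocalRing ((vanishingIdeal (⟨closure (β' ⁻¹' (closure (β ⁻¹' (closure T \
        ((vanishingIdeal (⟨{w (o k)}, hc⟩ : Closeds Y)).support : Set Y))) \
        ((vanishingIdeal (⟨β ⁻¹' {w (o k)} ∩ closure (β ⁻¹' (T \ {w (o k)})), isClosed_inter hc β⟩ : Closeds Y')).support :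
          Set Y'))), isClosed_closure⟩ : Closeds Y'')).subscheme.presheaf.stalk z)) ∧
    (∀ O : Y.Opens, w (o k) ∉ O →
      (∀ x : (vanishingIdeal (⟨closure T, isClosed_closure⟩ : Closeds Y)).subscheme,
        (vanishingIdeal (⟨closure T, isClosed_closure⟩ : Closeds Y)).subschemeι x ∈ O →
        IsRegularLocalRing ((vanishingIdeal (⟨closure T, isClosed_closure⟩ : Closeds Y)).subscheme.presheaf.stalk x)) →
      ∀ z : (vanishingIdeal (⟨closure (β' ⁻¹' (closure (β ⁻¹' (closure T \
        ((vanishingIdeal (⟨{w (o k)}, hc⟩ : Closeds Y)).support : Set Y))) \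
        ((vanishingIdeal (⟨β ⁻¹' {w (o k)} ∩ closure (β ⁻¹' (T \ {w (o k)})), isClosed_inter hc β⟩ : Closeds Y')).support :
          Set Y'))), isClosed_closure⟩ : Closeds Y'')).subscheme,
      β (β' ((vanishingIdeal (⟨closure (β' ⁻¹' (closure (β ⁻¹' (closure T \
        ((vanishingIdeal (⟨{w (o k)}, hc⟩ : Closeds Y)).support : Set Y))) \
        ((vanishingIdeal (⟨β ⁻¹' {w (o k)} ∩ closure (β ⁻¹' (T \ {w (o k)})), isClosed_inter hc β⟩ : Closeds Y')).support :
          Set Y'))), isClosed_closure⟩ : Closeds Y'')).subschemeι z)) ∈ O →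
      IsRegularLocalRing ((vanishingIdeal (⟨closure (β' ⁻¹' (closure (β ⁻¹' (closure T \
        ((vanishingIdeal (⟨{w (o k)}, hc⟩ : Closeds Y)).support : Set Y))) \
        ((vanishingIdeal (⟨β ⁻¹' {w (o k)} ∩ closure (β ⁻¹' (T \ {w (o k)})), isClosed_inter hc β⟩ : Closeds Y')).support :
          Set Y'))), isClosed_closure⟩ : Closeds Y'')).subscheme.presheaf.stalk z)) := by
  -- ### names
  set y₀ : Y := w (o k) with hy₀
  set C₁ : Y.IdealSheafData := vanishingIdeal (⟨{y₀}, hc⟩ : Closeds Y) with hC₁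
  set Z : Set Y' := β ⁻¹' {y₀} ∩ closure (β ⁻¹' (T \ {y₀})) with hZ
  set C₂ : Y'.IdealSheafData := vanishingIdeal (⟨Z, isClosed_inter hc β⟩ : Closeds Y') with hC₂
  set K := vanishingIdeal (⟨closure T, isClosed_closure⟩ : Closeds Y) with hK
  set S' : Set Y' := closure (β ⁻¹' (closure T \ (C₁.support : Set Y))) with hS'
  set K' := vanishingIdeal (⟨S', isClosed_closure⟩ : Closeds Y') with hK'
  set S'' : Set Y'' := closure (β' ⁻¹' (S' \ (C₂.support : Set Y'))) with hS''
  set K'' := vanishingIdeal (⟨S'', isClosed_closure⟩ : Closeds Y'') with hK''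
  have hsupp₁ : (C₁.support : Set Y) = {y₀} := Scheme.IdealSheafData.coe_support_vanishingIdeal _
  have hsupp₂ : (C₂.support : Set Y') = Z := Scheme.IdealSheafData.coe_support_vanishingIdeal _
  have hS'eq : S' = closure (β ⁻¹' (T \ {y₀})) := by rw [hS', hsupp₁, hTc.closure_eq]
  -- ### ambient facts
  haveI : IsLocallyNoetherian Y' := hβ.isLocallyNoetherian
  haveI : IsLocallyNoetherian Y'' := hβ'.isLocallyNoetherian
  haveI : IsProper β := hβ.isProper
  haveI : IsProper β' := hβ'.isProper
  have hux : (vanishingIdeal (⟨{y₀}, hc⟩ : Closeds Y)).comap w =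
      ofIdealTop ((PointBlowup.originIdeal 2 k).map (Scheme.ΓSpecIso (CommRingCat.of (MvPolynomial (Fin 3) k))).inv.hom) :=
    comap_vanishingIdeal_singleton_chart w hc
  have hc₉ := not_strict_subset_inter w hc hux hTc hwT h2 hβ
  -- ### the two reduced strict transforms as blow-ups (Stacks 080E)
  have hirr₀ : IsIrreducible (closure T) := hTirr.closure
  have hnot₁ : ¬ closure T ⊆ (C₁.support : Set Y) := by
    rw [hsupp₁, hTc.closure_eq]
    intro hsub
    apply hc₉
    have he : T \ {y₀} = ∅ := Set.sdiff_eq_empty.mpr hsub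
    rw [he, Set.preimage_empty, closure_empty]
    exact Set.empty_subset _
  obtain ⟨ρ₃, hsq₃, -, hρ₃⟩ := Cruxes.EquisingularLift.StrataSplit.exists_isBlowup_reducedStrictTransform Y Y' β C₁ hβ (closure T) isClosed_closure hirr₀ hnot₁
  have hS'irr : IsIrreducible S' := by
    rw [hS'eq]; exact isIrreducible_strictTransform_of_isBlowup ⟨{y₀}, hc⟩ hβ hTirr (fun hsub => hnot₁ (by
      rw [hsupp₁, hTc.closure_eq]; exact hsub))
  have hnot₂ : ¬ S' ⊆ (C₂.support : Set Y') := by rw [hsupp₂, hS'eq]; exact hc₉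
  obtain ⟨ρ₄, hsq₄, -, hρ₄⟩ := Cruxes.EquisingularLift.StrataSplit.exists_isBlowup_reducedStrictTransform Y' Y'' β' C₂ hβ' S' isClosed_closure hS'irr hnot₂
  -- ### the point `x₀` of `Γ` over `y₀` and the chart `φ : Spec D₀ → Γ`
  obtain ⟨x₀, hx₀⟩ := exists_point_subscheme_of_mem w hwo
  let φ := gammaChart w hTc hwT
  have hφtr := comap_gammaChart_trace_singleton w hTc hwT hc hx₀
  have hφpt : φ (pt k) = x₀ := by
    have h : pt k ∈ φ ⁻¹' {x₀} := by rw [preimage_gammaChart_singleton w hTc hwT hc hx₀]; exact Set.mem_singleton _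
    exact h
  let U : (vanishingIdeal (⟨closure T, isClosed_closure⟩ : Closeds Y)).subscheme.Opens := φ.opensRange
  have hrange : Set.range φ = Set.range U.ι := by rw [Scheme.Opens.range_ι]; rfl
  let e := IsOpenImmersion.isoOfRangeEq φ U.ι hrange
  have he : e.hom ≫ U.ι = φ := IsOpenImmersion.isoOfRangeEq_hom_fac _ _ _
  have hept : (e.hom (pt k)).1 = x₀ := by
    rw [← hφpt, ← he]; rfl
  -- ### the first restricted blow-up, moved to `Spec D₀`: a blow-up at `𝔪̄₀~`
  have hρ₁' : IsBlowup ((ρ₃ ∣_ U) ≫ e.symm.hom)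
      (ofIdealTop ((mbar k).map (Scheme.ΓSpecIso (CommRingCat.of (D₀ k))).inv.hom)) := by
    have h := (hρ₃.restrict U).comp_iso e.symm
    rw [← Scheme.IdealSheafData.comap_comp, Iso.symm_inv, he] at h
    change IsBlowup _ ((C₁.comap _).comap φ) at h
    rw [hφtr] at h
    exact h
  -- ### the second restricted blow-up: along `𝓘(ρ₁'⁻¹ pt)`
  have hrange' : Set.range (vanishingIdeal (⟨S', isClosed_closure⟩ : Closeds Y')).subschemeι = S' := by
    rw [range_subschemeι, Scheme.IdealSheafData.coe_support_vanishingIdeal]; rfl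
  have hinjΓ := (vanishingIdeal (⟨closure T, isClosed_closure⟩ : Closeds Y)).subschemeι.isClosedEmbedding.injective
  have hfib : IsClosed (ρ₃ ⁻¹' {x₀}) := (isClosed_singleton_of_subschemeι_eq w hc hx₀).preimage ρ₃.continuous
  have himage : (vanishingIdeal (⟨S', isClosed_closure⟩ : Closeds Y')).subschemeι '' (ρ₃ ⁻¹' {x₀}) = Z := by
    apply Set.Subset.antisymm
    · rintro _ ⟨y, hy, rfl⟩
      refine ⟨?_, ?_⟩
      · change β ((vanishingIdeal (⟨S', isClosed_closure⟩ : Closeds Y')).subschemeι y) = y₀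
        rw [← Scheme.Hom.comp_apply, ← hsq₃, Scheme.Hom.comp_apply, show ρ₃ y = x₀ from hy, hx₀]
      · exact (Set.ext_iff.mp (hrange'.trans hS'eq) _).mp (Set.mem_range_self y)
    · intro y' hy'
      have hy'S : y' ∈ Set.range (vanishingIdeal (⟨S', isClosed_closure⟩ : Closeds Y')).subschemeι :=
        (Set.ext_iff.mp (hrange'.trans hS'eq) _).mpr hy'.2
      obtain ⟨y, rfl⟩ := hy'S
      refine ⟨y, ?_, rfl⟩
      change ρ₃ y = x₀
      apply hinjΓ
      rw [hx₀, ← Scheme.Hom.comp_apply, hsq₃, Scheme.Hom.comp_apply]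
      exact hy'.1
  have hC₂tr : C₂.comap (vanishingIdeal (⟨S', isClosed_closure⟩ : Closeds Y')).subschemeι =
      vanishingIdeal (⟨ρ₃ ⁻¹' {x₀}, hfib⟩ : Closeds _) := by
    have h := comap_vanishingIdeal_image_of_isClosedImmersion (vanishingIdeal (⟨S', isClosed_closure⟩ : Closeds Y')).subschemeι
      ⟨ρ₃ ⁻¹' {x₀}, hfib⟩
    have hD : (⟨(vanishingIdeal (⟨S', isClosed_closure⟩ : Closeds Y')).subschemeι '' ((⟨ρ₃ ⁻¹' {x₀}, hfib⟩ : Closeds _) : Set _),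
        (vanishingIdeal (⟨S', isClosed_closure⟩ : Closeds Y')).subschemeι.isClosedEmbedding.isClosedMap _
          (⟨ρ₃ ⁻¹' {x₀}, hfib⟩ : Closeds _).2⟩ : Closeds Y') = ⟨Z, isClosed_inter hc β⟩ := Closeds.ext himage
    rw [hD] at h
    exact h
  have hρ₂' : IsBlowup (ρ₄ ∣_ (ρ₃ ⁻¹ᵁ U))
      (vanishingIdeal (⟨((ρ₃ ∣_ U) ≫ e.symm.hom) ⁻¹' {pt k},
        (isClosed_pt k).preimage ((ρ₃ ∣_ U) ≫ e.symm.hom).continuous⟩ : Closeds _)) := by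
    have h := hρ₄.restrict (ρ₃ ⁻¹ᵁ U)
    rw [hC₂tr, comap_vanishingIdeal_of_isOpenImmersion] at h
    have hpre : (Closeds.preimage (⟨ρ₃ ⁻¹' {x₀}, hfib⟩ : Closeds _) (ρ₃ ⁻¹ᵁ U).ι.continuous) =
        ⟨((ρ₃ ∣_ U) ≫ e.symm.hom) ⁻¹' {pt k}, (isClosed_pt k).preimage ((ρ₃ ∣_ U) ≫ e.symm.hom).continuous⟩ := by
      apply Closeds.ext
      change (ρ₃ ⁻¹ᵁ U).ι ⁻¹' (ρ₃ ⁻¹' {x₀}) = ((ρ₃ ∣_ U) ≫ e.symm.hom) ⁻¹' {pt k}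
      ext u
      simp only [Set.mem_preimage, Set.mem_singleton_iff, Scheme.Hom.comp_apply]
      change ρ₃ u.1 = x₀ ↔ e.inv ((ρ₃ ∣_ U) u) = pt k
      have h1 : ρ₃ u.1 = ((ρ₃ ∣_ U) u).1 := (morphismRestrict_base_coe ρ₃ U u).symm
      rw [h1]
      constructor
      · intro hu
        have h2 : (ρ₃ ∣_ U) u = e.hom (pt k) := Subtype.ext (hu.trans hept.symm)
        rw [h2, ← Scheme.Hom.comp_apply, Iso.hom_inv_id]; rfl
      · intro hu
        rw [← hept, ← hu, ← Scheme.Hom.comp_apply, Iso.inv_hom_id]; rfl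
    rw [hpre] at h
    exact h
  -- ### LOCAL TWO-STEP REGULARITY over the chart
  have hreg := isRegular_twoStep k (isUnit_iff_ne_zero.mpr h2) _ hρ₁' _ hρ₂'
  -- ### bookkeeping: where a point of `Γ″` goes
  have hdown : ∀ z : (vanishingIdeal (⟨S'', isClosed_closure⟩ : Closeds Y'')).subscheme,
      (vanishingIdeal (⟨closure T, isClosed_closure⟩ : Closeds Y)).subschemeι (ρ₃ (ρ₄ z)) =
        β (β' ((vanishingIdeal (⟨S'', isClosed_closure⟩ : Closeds Y'')).subschemeι z)) := by
    intro z
    rw [← Scheme.Hom.comp_apply, hsq₃, Scheme.Hom.comp_apply, ← Scheme.Hom.comp_apply ρ₄, hsq₄, Scheme.Hom.comp_apply]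
  refine ⟨fun z hz => ?_, fun O hO hregO z hz => ?_⟩
  · -- (1) over the chart
    have hzU : ρ₃ (ρ₄ z) ∈ U := by
      change ρ₃ (ρ₄ z) ∈ Set.range φ
      exact mem_range_gammaChart w hTc hwT (by rw [hdown]; exact hz)
    haveI := hreg ⟨z, hzU⟩
    exact IsRegularLocalRing.of_ringEquiv (asIso ((ρ₄ ⁻¹ᵁ (ρ₃ ⁻¹ᵁ U)).ι.stalkMap ⟨z, hzU⟩)).commRingCatIsoToRingEquiv.symm
  · -- (2) over an open `O ∌ y₀` where `Γ` is regular: both blow-ups are isomorphisms there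
    let W : (vanishingIdeal (⟨closure T, isClosed_closure⟩ : Closeds Y)).subscheme.Opens :=
      (vanishingIdeal (⟨closure T, isClosed_closure⟩ : Closeds Y)).subschemeι ⁻¹ᵁ O
    have hW₁ : (C₁.comap (vanishingIdeal (⟨closure T, isClosed_closure⟩ : Closeds Y)).subschemeι).comap W.ι = ⊤ := by
      rw [← Scheme.IdealSheafData.support_eq_bot_iff, Scheme.IdealSheafData.support_comap, Scheme.IdealSheafData.support_comap]
      ext u
      simp only [Closeds.coe_preimage, Set.mem_preimage, Closeds.coe_bot, Set.mem_empty_iff_false, iff_false]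
      intro hu
      rw [hsupp₁, Set.mem_singleton_iff] at hu
      have h3 : (vanishingIdeal (⟨closure T, isClosed_closure⟩ : Closeds Y)).subschemeι (W.ι u) ∈ O := u.2
      rw [hu] at h3
      exact hO h3
    haveI iso₃ : IsIso (ρ₃ ∣_ W) := by
      have h := hρ₃.restrict W
      rw [hW₁] at h
      exact h.isIso isEffectiveCartier_top
    have hW₂ : (C₂.comap (vanishingIdeal (⟨S', isClosed_closure⟩ : Closeds Y')).subschemeι).comap (ρ₃ ⁻¹ᵁ W).ι = ⊤ := by
      rw [← Scheme.IdealSheafData.support_eq_bot_iff, Scheme.IdealSheafData.support_comap, Scheme.IdealSheafData.support_comap]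
      ext u
      simp only [Closeds.coe_preimage, Set.mem_preimage, Closeds.coe_bot, Set.mem_empty_iff_false, iff_false]
      intro hu
      rw [hsupp₂] at hu
      have h1 : β ((vanishingIdeal (⟨S', isClosed_closure⟩ : Closeds Y')).subschemeι ((ρ₃ ⁻¹ᵁ W).ι u)) = y₀ := hu.1
      rw [← Scheme.Hom.comp_apply, ← hsq₃, Scheme.Hom.comp_apply] at h1
      apply hO
      have h2 : (vanishingIdeal (⟨closure T, isClosed_closure⟩ : Closeds Y)).subschemeι (ρ₃ ((ρ₃ ⁻¹ᵁ W).ι u)) ∈ O := u.2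
      rw [h1] at h2
      exact h2
    haveI iso₄ : IsIso (ρ₄ ∣_ (ρ₃ ⁻¹ᵁ W)) := by
      have h := hρ₄.restrict (ρ₃ ⁻¹ᵁ W)
      rw [hW₂] at h
      exact h.isIso isEffectiveCartier_top
    have hzW : ρ₃ (ρ₄ z) ∈ W := by
      change (vanishingIdeal (⟨closure T, isClosed_closure⟩ : Closeds Y)).subschemeι (ρ₃ (ρ₄ z)) ∈ O
      rw [hdown]; exact hz
    let u₁ : ↥(ρ₄ ⁻¹ᵁ (ρ₃ ⁻¹ᵁ W)) := ⟨z, hzW⟩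
    let u₂ : ↥(ρ₃ ⁻¹ᵁ W) := (ρ₄ ∣_ (ρ₃ ⁻¹ᵁ W)) u₁
    let u₃ : ↥W := (ρ₃ ∣_ W) u₂
    have r₀ : IsRegularLocalRing ((vanishingIdeal (⟨closure T, isClosed_closure⟩ : Closeds Y)).subscheme.presheaf.stalk (W.ι u₃)) :=
      hregO _ u₃.2
    have r₁ : IsRegularLocalRing ((W : Scheme.{0}).presheaf.stalk u₃) := by
      haveI := r₀; exact IsRegularLocalRing.of_ringEquiv (asIso (W.ι.stalkMap u₃)).commRingCatIsoToRingEquiv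
    have r₂ : IsRegularLocalRing ((↑(ρ₃ ⁻¹ᵁ W) : Scheme.{0}).presheaf.stalk u₂) := by
      haveI := r₁; exact IsRegularLocalRing.of_ringEquiv (asIso ((ρ₃ ∣_ W).stalkMap u₂)).commRingCatIsoToRingEquiv
    have r₃ : IsRegularLocalRing ((↑(ρ₄ ⁻¹ᵁ (ρ₃ ⁻¹ᵁ W)) : Scheme.{0}).presheaf.stalk u₁) := by
      haveI := r₂; exact IsRegularLocalRing.of_ringEquiv (asIso ((ρ₄ ∣_ (ρ₃ ⁻¹ᵁ W)).stalkMap u₁)).commRingCatIsoToRingEquiv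
    haveI := r₃
    exact IsRegularLocalRing.of_ringEquiv (asIso ((ρ₄ ⁻¹ᵁ (ρ₃ ⁻¹ᵁ W)).ι.stalkMap u₁)).commRingCatIsoToRingEquiv.symm


omit [IsAlgClosed k] [IsLocallyNoetherian Y] [IsOpenImmersion w] in
include hTc in
/-- The two spellings of the reduced second strict transform agree. [folklore] -/
theorem closeds_twoStep_eq (β' : Y'' ⟶ Y') :
    (⟨closure (β' ⁻¹' (closure (β ⁻¹' (closure T \ ((vanishingIdeal (⟨{w (o k)}, hc⟩ : Closeds Y)).support : Set Y))) \
        ((vanishingIdeal (⟨β ⁻¹' {w (o k)} ∩ closure (β ⁻¹' (T \ {w (o k)})), isClosed_inter hc β⟩ : Closeds Y')).support :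
          Set Y'))), isClosed_closure⟩ : Closeds Y'') =
      ⟨closure (β' ⁻¹' (closure (β ⁻¹' (T \ {w (o k)})) \ (β ⁻¹' {w (o k)} ∩ closure (β ⁻¹' (T \ {w (o k)}))))),
        isClosed_closure⟩ := by
  apply Closeds.ext
  change closure _ = closure _
  rw [Scheme.IdealSheafData.coe_support_vanishingIdeal, Scheme.IdealSheafData.coe_support_vanishingIdeal, hTc.closure_eq]
  rfl

end TwoStep

section TwoStepPublic

variable {k : Type} [Field k] [IsAlgClosed k]
variable {Y Y' Y'' : Scheme.{0}} [IsLocallyNoetherian Y]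
  (w : Spec (CommRingCat.of (MvPolynomial (Fin 3) k)) ⟶ Y) [IsOpenImmersion w]
  {y₀ : Y} (hy₀ : w (o k) = y₀) (hc : IsClosed ({y₀} : Set Y))
  {T : Set Y} (hTc : IsClosed T) (hTirr : IsIrreducible T)
  (hwT : (vanishingIdeal (⟨T, hTc⟩ : Closeds Y)).comap w =
    ofIdealTop ((Ideal.span {(X 2 ^ 2 + X 0 ^ 4 + X 1 ^ 4 : MvPolynomial (Fin 3) k)}).map
      (Scheme.ΓSpecIso (CommRingCat.of (MvPolynomial (Fin 3) k))).inv.hom))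
  (hwo : y₀ ∈ T) (h2 : (2 : k) ≠ 0)
  {β : Y' ⟶ Y} (hβ : IsBlowup β (vanishingIdeal (⟨{y₀}, hc⟩ : Closeds Y)))
  {β' : Y'' ⟶ Y'}
  (hβ' : IsBlowup β' (vanishingIdeal (⟨β ⁻¹' {y₀} ∩ closure (β ⁻¹' (T \ {y₀})), isClosed_inter hc β⟩ : Closeds Y')))

include hy₀ hTirr hwT hwo h2 hβ hβ' in
/-- **GLOBAL TWO-STEP REGULARITY (1)**: the reduced second strict transform `V(closure T″)_red` is regular at every point over
the chart `w(Spec k[X])`. [OURS · L1 W4.5b · SPECIMEN-Q DOWNSTAIRS R1] [cite: StacksProject, Tag 080E] -/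
theorem isRegularLocalRing_twoStep_of_mem_range
    (z : (vanishingIdeal (⟨closure (β' ⁻¹' (closure (β ⁻¹' (T \ {y₀})) \
      (β ⁻¹' {y₀} ∩ closure (β ⁻¹' (T \ {y₀}))))), isClosed_closure⟩ : Closeds Y'')).subscheme)
    (hz : β (β' ((vanishingIdeal (⟨closure (β' ⁻¹' (closure (β ⁻¹' (T \ {y₀})) \
      (β ⁻¹' {y₀} ∩ closure (β ⁻¹' (T \ {y₀}))))), isClosed_closure⟩ : Closeds Y'')).subschemeι z)) ∈ Set.range w) :
    IsRegularLocalRing ((vanishingIdeal (⟨closure (β' ⁻¹' (closure (β ⁻¹' (T \ {y₀})) \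
      (β ⁻¹' {y₀} ∩ closure (β ⁻¹' (T \ {y₀}))))), isClosed_closure⟩ : Closeds Y'')).subscheme.presheaf.stalk z) := by
  subst hy₀
  have H := (twoStep_core w hc hTc hTirr hwT hwo h2 hβ hβ').1
  rw [closeds_twoStep_eq w hc hTc β'] at H
  exact H z hz

include hy₀ hTirr hwT hwo h2 hβ hβ' in
/-- **GLOBAL TWO-STEP REGULARITY (2)**: the reduced second strict transform is regular at every point over an open `O ∌ w(o)` over
which `V(closure T)_red` is regular (both blow-ups are isomorphisms there). [OURS · L1 W4.5b · SPECIMEN-Q DOWNSTAIRS R1]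
[cite: StacksProject, Tag 080E] -/
theorem isRegularLocalRing_twoStep_of_mem_open (O : Y.Opens) (hO : y₀ ∉ O)
    (hregO : ∀ x : (vanishingIdeal (⟨closure T, isClosed_closure⟩ : Closeds Y)).subscheme,
      (vanishingIdeal (⟨closure T, isClosed_closure⟩ : Closeds Y)).subschemeι x ∈ O →
      IsRegularLocalRing ((vanishingIdeal (⟨closure T, isClosed_closure⟩ : Closeds Y)).subscheme.presheaf.stalk x))
    (z : (vanishingIdeal (⟨closure (β' ⁻¹' (closure (β ⁻¹' (T \ {y₀})) \
      (β ⁻¹' {y₀} ∩ closure (β ⁻¹' (T \ {y₀}))))), isClosed_closure⟩ : Closeds Y'')).subscheme)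
    (hz : β (β' ((vanishingIdeal (⟨closure (β' ⁻¹' (closure (β ⁻¹' (T \ {y₀})) \
      (β ⁻¹' {y₀} ∩ closure (β ⁻¹' (T \ {y₀}))))), isClosed_closure⟩ : Closeds Y'')).subschemeι z)) ∈ O) :
    IsRegularLocalRing ((vanishingIdeal (⟨closure (β' ⁻¹' (closure (β ⁻¹' (T \ {y₀})) \
      (β ⁻¹' {y₀} ∩ closure (β ⁻¹' (T \ {y₀}))))), isClosed_closure⟩ : Closeds Y'')).subscheme.presheaf.stalk z) := by
  subst hy₀
  have H := (twoStep_core w hc hTc hTirr hwT hwo h2 hβ hβ').2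
  rw [closeds_twoStep_eq w hc hTc β'] at H
  exact H O hO hregO z hz


omit [IsAlgClosed k] [IsLocallyNoetherian Y] [IsOpenImmersion w] in
/-- The «double closure» spelling (as the (TC) constructor iterates it) of the reduced second strict transform. [folklore] -/
theorem closeds_twoStep_eq' (β' : Y'' ⟶ Y') :
    (⟨closure (β' ⁻¹' (closure (β ⁻¹' (T \ {y₀})) \ (β ⁻¹' {y₀} ∩ closure (β ⁻¹' (T \ {y₀}))))),
        isClosed_closure⟩ : Closeds Y'') =
      ⟨closure (closure (β' ⁻¹' (closure (β ⁻¹' (T \ {y₀})) \ (β ⁻¹' {y₀} ∩ closure (β ⁻¹' (T \ {y₀})))))),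
        isClosed_closure⟩ := by
  apply Closeds.ext
  change closure _ = closure (closure _)
  rw [closure_closure]

include hy₀ hTirr hwT hwo h2 hβ hβ' in
/-- **GLOBAL TWO-STEP REGULARITY (1), «double closure» spelling**: `V(closure (closure T″))_red` is regular at every point over the
chart `w(Spec k[X])`. [OURS · L1 W4.5b · SPECIMEN-Q DOWNSTAIRS R1] [cite: StacksProject, Tag 080E] -/
theorem isRegularLocalRing_twoStep_of_mem_range'
    (z : (vanishingIdeal (⟨closure (closure (β' ⁻¹' (closure (β ⁻¹' (T \ {y₀})) \
      (β ⁻¹' {y₀} ∩ closure (β ⁻¹' (T \ {y₀})))))), isClosed_closure⟩ : Closeds Y'')).subscheme)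
    (hz : β (β' ((vanishingIdeal (⟨closure (closure (β' ⁻¹' (closure (β ⁻¹' (T \ {y₀})) \
      (β ⁻¹' {y₀} ∩ closure (β ⁻¹' (T \ {y₀})))))), isClosed_closure⟩ : Closeds Y'')).subschemeι z)) ∈ Set.range w) :
    IsRegularLocalRing ((vanishingIdeal (⟨closure (closure (β' ⁻¹' (closure (β ⁻¹' (T \ {y₀})) \
      (β ⁻¹' {y₀} ∩ closure (β ⁻¹' (T \ {y₀})))))), isClosed_closure⟩ : Closeds Y'')).subscheme.presheaf.stalk z) := by
  have H := isRegularLocalRing_twoStep_of_mem_range w hy₀ hc hTc hTirr hwT hwo h2 hβ hβ'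
  rw [closeds_twoStep_eq' (y₀ := y₀) (T := T) (β := β) β'] at H
  exact H z hz

include hy₀ hTirr hwT hwo h2 hβ hβ' in
/-- **GLOBAL TWO-STEP REGULARITY (2), «double closure» spelling.** [OURS · L1 W4.5b · SPECIMEN-Q DOWNSTAIRS R1] [cite: StacksProject, Tag 080E] -/
theorem isRegularLocalRing_twoStep_of_mem_open' (O : Y.Opens) (hO : y₀ ∉ O)
    (hregO : ∀ x : (vanishingIdeal (⟨closure T, isClosed_closure⟩ : Closeds Y)).subscheme,
      (vanishingIdeal (⟨closure T, isClosed_closure⟩ : Closeds Y)).subschemeι x ∈ O →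
      IsRegularLocalRing ((vanishingIdeal (⟨closure T, isClosed_closure⟩ : Closeds Y)).subscheme.presheaf.stalk x))
    (z : (vanishingIdeal (⟨closure (closure (β' ⁻¹' (closure (β ⁻¹' (T \ {y₀})) \
      (β ⁻¹' {y₀} ∩ closure (β ⁻¹' (T \ {y₀})))))), isClosed_closure⟩ : Closeds Y'')).subscheme)
    (hz : β (β' ((vanishingIdeal (⟨closure (closure (β' ⁻¹' (closure (β ⁻¹' (T \ {y₀})) \
      (β ⁻¹' {y₀} ∩ closure (β ⁻¹' (T \ {y₀})))))), isClosed_closure⟩ : Closeds Y'')).subschemeι z)) ∈ O) :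
    IsRegularLocalRing ((vanishingIdeal (⟨closure (closure (β' ⁻¹' (closure (β ⁻¹' (T \ {y₀})) \
      (β ⁻¹' {y₀} ∩ closure (β ⁻¹' (T \ {y₀})))))), isClosed_closure⟩ : Closeds Y'')).subscheme.presheaf.stalk z) := by
  have H := isRegularLocalRing_twoStep_of_mem_open w hy₀ hc hTc hTirr hwT hwo h2 hβ hβ' O hO hregO
  rw [closeds_twoStep_eq' (y₀ := y₀) (T := T) (β := β) β'] at H
  exact H z hz

end TwoStepPublic

end SpecimenQuarticTcDelta

end Summit.ResolutionOfSingularities.ResolutionOfSingularities.Cruxes.EquisingularLiftNat.Sections
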